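import Literature.AlgebraicGeometry.HodgeTheory.BettiUniverseTracePairing
import Literature.AlgebraicGeometry.HodgeTheory.BettiUniverseOddCupAlternating
import Literature.AlgebraicGeometry.Motives.MumfordTateGroupTransport
import HarnessLib

/-!
# Transport of the light Betti–Hodge universe along an isomorphism of varieties: cohomology, Hodge
# structure, Hodge group, trace pairing, eigen-Hodge numbers (proved; one plumbing definition)

Family `hodge`, layer `Literature/AlgebraicGeometry/HodgeTheory`. Written by the cross-ladder
literature-typing seat `littype-FH1-2` (cell `hodge-nonav`) for the registered K1 line `andre-zariski`
of the route `HodgeConjecture/SignSymmetricPowers` (stub `stub_modelTransfer`, "K1 for the model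
hypersurfaces `X_f` with the CANONICAL deck transformation `diagonalAut f ha` implies K1: every `X`
with `IsHypersurfaceCutOutBy 4 f X` is isomorphic to `X_f`; transport `σ`, `Deck` and `Comm` along the
isomorphism") and for its stub `stub_signPencilEnvelope` (clauses (HG) "a fibre identification
`φ : H³(𝒳_s;ℚ) ≃ H³(X_f;ℚ)` transporting Hodge groups" and (COMPAT)). Everything a transport of the
route's clauses `Deck`, `Cen`, `Comm` along an isomorphism `e : X ≅ X'` of smooth projective varieties
needs, on the LIGHT carriers of `BettiUniverseAxioms` (`pull`, `cup`, `tr`, `hodge`):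

* `pullEquiv e k : Hᵏ(X(ℂ); ℚ) ≃ₗ[ℚ] Hᵏ(X'(ℂ); ℚ)` — the linear equivalence `(e⁻¹)^*` with inverse
  `e^*` (the one definition of the file; Hatcher §3.1: `(e ≫ e⁻¹)^* = id`).
* §1 `pull_conj_of_iso` — `(e ≫ σ' ≫ e⁻¹)^* = e^* ∘ σ'^* ∘ (e⁻¹)^*`: the deck of `X` transported
  from a deck `σ'` of `X'` acts by the conjugate.
* §2 **The Hodge structure transports**: `hodge hHD hX k = (hodge hHD hX' k).comapEquiv (pullEquiv e k)`
  (`hodge_eq_comapEquiv_of_iso`; pull-backs along `e` and `e⁻¹` are morphisms of Hodge structures,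
  Voisin I §7.3.2, the tree's `pull_hodge`), and **does not depend on the Hodge model**:
  `A.hodgeStructure hX hA k = hodge hHD hX k` for every Hodge-symmetric model `A`
  (`HodgeModel.hodgeStructure_eq_hodge`, from the model-independence of `H^{p,q}`, hypothesis `hI`,
  PROVED in the tree as `hodgePQ_independent_of_hodgeModel_holds`) — this identifies the Hodge
  structure `(A s).hodgeStructure …` of a fibre of a family (the carrier of
  `deligne_finiteIndex_monodromy_le_mumfordTateGroup`) with the route's `BettiUniverse.hodge`.
* §3 **The Hodge group transports by conjugation** (Deligne 1982 I Prop. 3.4 via the tree's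
  `mem_hodgeGroup_comapEquiv_iff`): `g ∈ Hg(Hᵏ(X)) ↔ φ⁻¹ g φ ∈ Hg(Hᵏ(X'))`, `φ = pullEquiv e k`
  (`mem_hodgeGroup_iff_of_iso`, the form read from `X'` `mem_hodgeGroup_iff_of_iso'`, and the
  bracket shape of clause (HG) of `stub_signPencilEnvelope`, `mem_hodgeGroup_of_iso`, once §2 has
  identified the fibre's model Hodge structure with `BettiUniverse.hodge`).
* §4 **The light trace transports up to a non-zero scalar**: `tr_X ∘ e^* = c · tr_{X'}`, `c ≠ 0`, in
  every degree (`exists_tr_comp_pull_eq_mul_of_iso`; both are non-zero functionals on the line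
  `H²ⁿ`, Hatcher Thm. 3.26), hence **trace isometries and `σ^*`-commuting maps transport by
  conjugation** (`tr_cup_conj_conj_of_iso`, `tr_cup_pull_conj_of_iso`, `comm_conj_of_iso`): the
  clauses `Cen`/`Deck (ii)`; with §1 `pull_conj_sq_eq_one_of_iso` (`Deck (i)`) and §3 this gives
  §4b **the commutator clause `Comm` transports** (`commutator_mem_hodgeGroup_of_iso`, `comm_of_iso`).
* §5 **Eigen-Hodge numbers transport**: for `σ = e ≫ σ' ≫ e⁻¹`,
  `dim (E_μ(σ^*_ℂ) ∩ H^{p,q}(X)) = dim (E_μ(σ'^*_ℂ) ∩ H^{p,q}(X'))`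
  (`finrank_eigenspace_inf_piece_eq_of_iso`; clause (iii) of `Deck`).

* §6 **The transport kit of a fibre identification** (appended): for `e : Y ≅ X'` and a deck `σ'` of
  `X'` with `(σ'^*)² = 1` preserving `tr ∘ ∪` on `Hᵏ(X')`, the triple `φ := (e⁻¹)^*`,
  `B := φ^*(tr_{X'} ∘ ∪)` (`B x y = tr_{X'}(φ x ∪ φ y)`), `τ := (e ≫ σ' ≫ e⁻¹)^* = φ⁻¹ σ'^* φ` on `Hᵏ(Y)`
  satisfies: `τ² = 1`, `B` is `τ`-invariant, `φ τ = σ'^* φ`, `B` is alternating for odd `k` and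
  non-degenerate for `k = dim` (Poincaré duality on `X'`), and `φ` carries the Hodge group of ANY
  Hodge-symmetric model of `Y` into that of `X'` — clauses (COMPAT) and (HG) of `stub_signPencilEnvelope`
  packaged in its quantifier order (`exists_transportKit`).

No named fact is introduced (D-0026).

## References

* [VoisinHodgeI2002] C. Voisin, Hodge Theory and Complex Algebraic Geometry I, CUP 2002, §7.3.2
  ("the morphism `φ^*` is a morphism of Hodge structures"), §7.1.1 (independence of the model).
* [Deligne1982HodgeCycles] P. Deligne, Hodge cycles on abelian varieties, LNM 900 (1982), I Prop. 3.4.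
* [HatcherAT2002] A. Hatcher, Algebraic Topology, CUP 2002, §3.1 p. 198, §3.3 Thm. 3.26.
-/

noncomputable section

open scoped TensorProduct
open CategoryTheory Module
open Literature.AlgebraicTopology.SingularHomology
open Literature.AlgebraicGeometry.Motives (bettiCohomology IsSmoothProjective ComplexPoints HodgeStructure)

namespace Literature.AlgebraicGeometry.HodgeTheory

namespace BettiUniverse

section HodgeTheory

variable {n m : ℕ} {X X' : Motives.SchemeOver ℂ}

/-! ### The linear equivalence `(e⁻¹)^* : Hᵏ(X) ≃ Hᵏ(X')` of an isomorphism `e : X ≅ X'` -/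

/-- **The identification of cohomology along an isomorphism of varieties**: for `e : X ≅ X'` over
`ℂ`, `pullEquiv e k : Hᵏ(X(ℂ); ℚ) ≃ₗ[ℚ] Hᵏ(X'(ℂ); ℚ)` is `(e⁻¹)^*` with inverse `e^*`
(`(e ≫ e⁻¹)^* = id`, `(e⁻¹ ≫ e)^* = id`). [cite: HatcherAT2002, §3.1 p. 198] -/
def pullEquiv (e : X ≅ X') (k : ℕ) : bettiCohomology X k ≃ₗ[ℚ] bettiCohomology X' k :=
  LinearEquiv.ofLinear (pull e.inv k) (pull e.hom k)
    (by rw [← pull_comp, Iso.inv_hom_id, pull_id])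
    (by rw [← pull_comp, Iso.hom_inv_id, pull_id])

/-- `pullEquiv e k x = (e⁻¹)^* x`. [cite: HatcherAT2002, §3.1 p. 198] -/
@[simp]
theorem pullEquiv_apply (e : X ≅ X') (k : ℕ) (x : bettiCohomology X k) :
    pullEquiv e k x = pull e.inv k x := rfl

/-- `(pullEquiv e k)⁻¹ y = e^* y`. [cite: HatcherAT2002, §3.1 p. 198] -/
@[simp]
theorem pullEquiv_symm_apply (e : X ≅ X') (k : ℕ) (y : bettiCohomology X' k) :
    (pullEquiv e k).symm y = pull e.hom k y := rfl

/-- The underlying linear map of `pullEquiv e k` is `(e⁻¹)^*`. [cite: HatcherAT2002, §3.1 p. 198] -/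
theorem pullEquiv_toLinearMap (e : X ≅ X') (k : ℕ) :
    (pullEquiv e k).toLinearMap = pull e.inv k := rfl

/-- The underlying linear map of `(pullEquiv e k)⁻¹` is `e^*`. [cite: HatcherAT2002, §3.1 p. 198] -/
theorem pullEquiv_symm_toLinearMap (e : X ≅ X') (k : ℕ) :
    (pullEquiv e k).symm.toLinearMap = pull e.hom k := rfl

/-- `e^* ((e⁻¹)^* x) = x`. [cite: HatcherAT2002, §3.1 p. 198] -/
theorem pull_hom_pull_inv_apply (e : X ≅ X') (k : ℕ) (x : bettiCohomology X k) :
    pull e.hom k (pull e.inv k x) = x := by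
  rw [← LinearMap.comp_apply, ← pull_comp, e.hom_inv_id, pull_id, LinearMap.id_apply]

/-- `(e⁻¹)^* (e^* y) = y`. [cite: HatcherAT2002, §3.1 p. 198] -/
theorem pull_inv_pull_hom_apply (e : X ≅ X') (k : ℕ) (y : bettiCohomology X' k) :
    pull e.inv k (pull e.hom k y) = y := by
  rw [← LinearMap.comp_apply, ← pull_comp, e.inv_hom_id, pull_id, LinearMap.id_apply]

/-! ### §1 The transported deck acts by the conjugate -/

/-- **`(e ≫ σ' ≫ e⁻¹)^* = e^* ∘ σ'^* ∘ (e⁻¹)^*`**: the endomorphism of `X` obtained by transporting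
`σ' : X' ⟶ X'` along `e` acts on `Hᵏ(X(ℂ); ℚ)` by the conjugate of `σ'^*`. [cite: HatcherAT2002, §3.1 p. 198] -/
theorem pull_conj_of_iso (e : X ≅ X') (σ' : X' ⟶ X') (k : ℕ) :
    pull (e.hom ≫ σ' ≫ e.inv) k = pull e.hom k ∘ₗ pull σ' k ∘ₗ pull e.inv k := by
  rw [pull_comp, pull_comp]

/-- Pointwise form: `(e ≫ σ' ≫ e⁻¹)^* x = e^* (σ'^* ((e⁻¹)^* x))`. [cite: HatcherAT2002, §3.1 p. 198] -/
theorem pull_conj_of_iso_apply (e : X ≅ X') (σ' : X' ⟶ X') (k : ℕ) (x : bettiCohomology X k) :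
    pull (e.hom ≫ σ' ≫ e.inv) k x = pull e.hom k (pull σ' k (pull e.inv k x)) := by
  rw [pull_conj_of_iso]; rfl

/-- An involution transports to an involution: `σ' ≫ σ' = 𝟙 ⇒ (e ≫ σ' ≫ e⁻¹) ≫ (e ≫ σ' ≫ e⁻¹) = 𝟙`
(conjugation by an isomorphism is multiplicative). [cite: KashiwaraSchapira2006, §1.2 (isomorphisms)] -/
theorem conj_comp_conj_of_comp_self_eq_id (e : X ≅ X') {σ' : X' ⟶ X'} (h : σ' ≫ σ' = 𝟙 X') :
    (e.hom ≫ σ' ≫ e.inv) ≫ (e.hom ≫ σ' ≫ e.inv) = 𝟙 X := by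
  simp only [Category.assoc, Iso.inv_hom_id_assoc]
  rw [← Category.assoc σ', h, Category.id_comp, Iso.hom_inv_id]

/-- **`(σ'^*)² = 1 ⇒ ((e ≫ σ' ≫ e⁻¹)^*)² = 1`** in `Module.End ℚ Hᵏ`: clause (i) of the routes' `Deck`
passes from `σ'` on the model `X'` to the transported morphism of `X` (only the COHOMOLOGICAL
involutivity is assumed, as in the clause). [cite: HatcherAT2002, §3.1 p. 198] -/
theorem pull_conj_sq_eq_one_of_iso (e : X ≅ X') {σ' : X' ⟶ X'} {k : ℕ} (h : pull σ' k ^ 2 = 1) :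
    pull (e.hom ≫ σ' ≫ e.inv) k ^ 2 = 1 := by
  have hS : ∀ y, pull σ' k (pull σ' k y) = y := fun y ↦ by
    have hy := LinearMap.congr_fun h y
    rwa [sq, Module.End.mul_apply, Module.End.one_apply] at hy
  rw [sq, Module.End.mul_eq_comp, pull_conj_of_iso]
  refine LinearMap.ext fun x ↦ ?_
  rw [LinearMap.comp_apply, Module.End.one_apply, LinearMap.comp_apply, LinearMap.comp_apply,
    LinearMap.comp_apply, LinearMap.comp_apply, pull_inv_pull_hom_apply, hS, pull_hom_pull_inv_apply]

/-! ### §2 The Hodge structure transports and is model-independent -/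

/-- **The Hodge structure on `Hᵏ(X(ℂ); ℚ)` is the transport of that of `Hᵏ(X'(ℂ); ℚ)` along
`(e⁻¹)^*`** for an isomorphism `e : X ≅ X'` of smooth projective varieties: both `e^*` and `(e⁻¹)^*`
are morphisms of Hodge structures (`pull_hodge`, Voisin I §7.3.2, over the model-independence
hypothesis `hI`), so `Fᵖ Hᵏ(X) = ((e⁻¹)^* ⊗ ℂ)⁻¹ Fᵖ Hᵏ(X')`. [cite: VoisinHodgeI2002, §7.3.2 (PDF p. 150)] -/
theorem hodge_eq_comapEquiv_of_iso (hHD : exists_isReal_hodgeModel)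
    (hI : hodgePQ_independent_of_hodgeModel) (hX : IsSmoothProjective n X)
    (hX' : IsSmoothProjective m X') (e : X ≅ X') (k : ℕ) :
    hodge hHD hX k = (hodge hHD hX' k).comapEquiv (pullEquiv e k) := by
  ext p x
  rw [HodgeStructure.comapEquiv_F, Submodule.mem_comap, pullEquiv_toLinearMap]
  constructor
  · intro hx
    exact pull_hodge hHD hI hX' hX e.inv k p ⟨x, hx, rfl⟩
  · intro hx
    have h := pull_hodge hHD hI hX hX' e.hom k p ⟨_, hx, rfl⟩
    rwa [← LinearMap.comp_apply, ← LinearMap.baseChange_comp, ← pull_comp, e.hom_inv_id, pull_id,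
      LinearMap.baseChange_id, LinearMap.id_apply] at h

/-- On the pieces: `H^{p,q}(X) = ((e⁻¹)^* ⊗ ℂ)⁻¹ H^{p,q}(X')` (the hypothesis `hI` is the tree's theorem
`hodgePQ_independent_of_hodgeModel_holds`, supplied by the consumer). [cite: VoisinHodgeI2002, §7.3.2 (PDF p. 150)] -/
theorem hodge_piece_eq_comap_of_iso (hHD : exists_isReal_hodgeModel)
    (hI : hodgePQ_independent_of_hodgeModel) (hX : IsSmoothProjective n X)
    (hX' : IsSmoothProjective m X') (e : X ≅ X') (k : ℕ) (p q : ℤ) :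
    (hodge hHD hX k).piece p q =
      ((hodge hHD hX' k).piece p q).comap ((pull e.inv k).baseChange ℂ) := by
  rw [hodge_eq_comapEquiv_of_iso hHD hI hX hX' e k, HodgeStructure.comapEquiv_piece,
    pullEquiv_toLinearMap]

/-- **The Hodge structure of a Hodge model is THE Hodge structure**: for every Hodge-symmetric Hodge
model `A` of a smooth projective `X`, `A.hodgeStructure hX hA k = hodge hHD hX k` (the subspaces
`H^{p,q}`, hence the filtration, do not depend on the model — hypothesis `hI`, PROVED in the tree as
`hodgePQ_independent_of_hodgeModel_holds`; the identity `𝟙 X` is a morphism of Hodge structures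
between the two models in both directions, the tree's `HodgeModel.hodgeStructureHom`).
[cite: VoisinHodgeI2002, §7.1.1 and §7.3.2] -/
theorem _root_.Literature.AlgebraicGeometry.HodgeTheory.HodgeModel.hodgeStructure_eq_hodge
    (hHD : exists_isReal_hodgeModel) (hI : hodgePQ_independent_of_hodgeModel)
    (hX : IsSmoothProjective n X) (A : HodgeModel n X) (hA : A.IsHodgeSymmetric) (k : ℕ) :
    A.hodgeStructure hX hA k = hodge hHD hX k := by
  have key : ∀ (B C : HodgeModel n X) (hB : B.IsHodgeSymmetric) (hC : C.IsHodgeSymmetric) (p : ℤ),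
      (B.hodgeStructure hX hB k).F p ≤ (C.hodgeStructure hX hC k).F p := by
    intro B C hB hC p x hx
    have h := (B.hodgeStructureHom hX hI hB C hX hC (𝟙 X) k).map_F_le p ⟨x, hx, rfl⟩
    have hid : (B.hodgeStructureHom hX hI hB C hX hC (𝟙 X) k).toLinearMap = LinearMap.id := by
      change pull (𝟙 X) k = LinearMap.id
      exact pull_id X k
    rwa [hid, LinearMap.baseChange_id, LinearMap.id_apply] at h
  ext p x
  exact ⟨fun hx ↦ key A _ hA _ p hx, fun hx ↦ key _ A _ hA p hx⟩

/-! ### §3 The Hodge group transports by conjugation -/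

/-- **`g ∈ Hg(Hᵏ(X)) ↔ φ g φ⁻¹ ∈ Hg(Hᵏ(X'))`, `φ = (e⁻¹)^*`** (`Hg(φ^* H) = φ⁻¹ Hg(H) φ`, Deligne
1982 I Prop. 3.4, the tree's `mem_hodgeGroup_comapEquiv_iff`, applied to §2). In Mathlib's
composition order `φ⁻¹ ≫ g ≫ φ = (pullEquiv e k).symm.trans (g.trans (pullEquiv e k))`.
[cite: Deligne1982HodgeCycles, I Prop. 3.4] [cite: VoisinHodgeI2002, §7.3.2] -/
theorem mem_hodgeGroup_iff_of_iso [Motives.HodgeTensorFacts.{0, 0}] (hHD : exists_isReal_hodgeModel)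
    (hI : hodgePQ_independent_of_hodgeModel) (hX : IsSmoothProjective n X)
    (hX' : IsSmoothProjective m X') (e : X ≅ X') (k : ℕ)
    (g : bettiCohomology X k ≃ₗ[ℚ] bettiCohomology X k) :
    haveI := finite hX k; haveI := finite hX' k
    g ∈ (hodge hHD hX k).hodgeGroup ↔
      (pullEquiv e k).symm.trans (g.trans (pullEquiv e k)) ∈ (hodge hHD hX' k).hodgeGroup := by
  haveI := finite hX k; haveI := finite hX' k
  rw [hodge_eq_comapEquiv_of_iso hHD hI hX hX' e k]
  exact HodgeStructure.mem_hodgeGroup_comapEquiv_iff _ _ _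

/-- **Read from `X'`: `g' ∈ Hg(Hᵏ(X')) ↔ φ⁻¹ g' φ ∈ Hg(Hᵏ(X))`**, `φ⁻¹ g' φ = φ.trans (g'.trans φ.symm)`,
`φ = pullEquiv e k` (the tree's `mem_hodgeGroup_iff_comapEquiv` applied to §2).
[cite: Deligne1982HodgeCycles, I Prop. 3.4] [cite: VoisinHodgeI2002, §7.3.2] -/
theorem mem_hodgeGroup_iff_of_iso' [Motives.HodgeTensorFacts.{0, 0}] (hHD : exists_isReal_hodgeModel)
    (hI : hodgePQ_independent_of_hodgeModel) (hX : IsSmoothProjective n X)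
    (hX' : IsSmoothProjective m X') (e : X ≅ X') (k : ℕ)
    (g' : bettiCohomology X' k ≃ₗ[ℚ] bettiCohomology X' k) :
    haveI := finite hX k; haveI := finite hX' k
    g' ∈ (hodge hHD hX' k).hodgeGroup ↔
      (pullEquiv e k).trans (g'.trans (pullEquiv e k).symm) ∈ (hodge hHD hX k).hodgeGroup := by
  haveI := finite hX k; haveI := finite hX' k
  rw [hodge_eq_comapEquiv_of_iso hHD hI hX hX' e k]
  exact HodgeStructure.mem_hodgeGroup_iff_comapEquiv _ _ _

/-- The push-forward direction in the bracket shape of clause (HG) of `stub_signPencilEnvelope`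
(`∀ k', k' ∈ Hg(fibre) → (φ.symm.trans k').trans φ ∈ Hg(X_f)`, `φ : H(fibre) ≃ H(X_f)`): with the
fibre `X`, the model `X'` and `φ = pullEquiv e k`. [cite: Deligne1982HodgeCycles, I Prop. 3.4] -/
theorem mem_hodgeGroup_of_iso [Motives.HodgeTensorFacts.{0, 0}] (hHD : exists_isReal_hodgeModel)
    (hI : hodgePQ_independent_of_hodgeModel) (hX : IsSmoothProjective n X)
    (hX' : IsSmoothProjective m X') (e : X ≅ X') (k : ℕ)
    (g : bettiCohomology X k ≃ₗ[ℚ] bettiCohomology X k) :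
    haveI := finite hX k; haveI := finite hX' k
    g ∈ (hodge hHD hX k).hodgeGroup →
      ((pullEquiv e k).symm.trans g).trans (pullEquiv e k) ∈ (hodge hHD hX' k).hodgeGroup :=
  fun hg ↦ (mem_hodgeGroup_iff_of_iso hHD hI hX hX' e k g).1 hg

/-! ### §4 The light trace and the trace pairing transport up to a non-zero scalar -/

/-- Two non-zero linear functionals on a line are proportional by a non-zero scalar. [folklore] -/
private theorem exists_ne_zero_eq_smul_of_finrank_eq_one' {K V : Type*} [Field K] [AddCommGroup V]
    [Module K V] (h1 : finrank K V = 1) (φ ψ : V →ₗ[K] K) (hφ : φ ≠ 0) (hψ : ψ ≠ 0) :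
    ∃ c : K, c ≠ 0 ∧ φ = c • ψ := by
  obtain ⟨v, hv⟩ := DFunLike.ne_iff.1 hψ
  rw [LinearMap.zero_apply] at hv
  have hv0 : v ≠ 0 := fun h ↦ hv (by rw [h, map_zero])
  have hc : φ = (φ v / ψ v) • ψ := by
    refine LinearMap.ext fun w ↦ ?_
    obtain ⟨a, rfl⟩ := (finrank_eq_one_iff_of_nonzero' v hv0).1 h1 w
    rw [LinearMap.smul_apply, map_smul, map_smul, smul_eq_mul, smul_eq_mul, smul_eq_mul]
    field_simp
  refine ⟨φ v / ψ v, ?_, hc⟩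
  intro h0
  exact hφ (by rw [hc, h0, zero_smul])

/-- **The light trace transports up to a non-zero rational scalar**: for an isomorphism `e : X ≅ X'`
of smooth projective `n`-folds there is `c ≠ 0` with `tr_X(e^* z) = c · tr_{X'}(z)` for all degrees
`k` and all `z ∈ Hᵏ(X'(ℂ); ℚ)` (in the top degree both `tr_X ∘ e^*` and `tr_{X'}` are non-zero linear
functionals on the line `H²ⁿ(X'(ℂ); ℚ)`, Hatcher Thm. 3.26; off it both vanish). The light trace is a
coordinate along a CHOSEN generator, so `c = 1` cannot be expected. [cite: HatcherAT2002, §3.3 Thm. 3.26] -/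
theorem exists_tr_comp_pull_eq_mul_of_iso (hX : IsSmoothProjective n X) (hX' : IsSmoothProjective n X')
    (e : X ≅ X') :
    ∃ c : ℚ, c ≠ 0 ∧ ∀ (k : ℕ) (z : bettiCohomology X' k), tr hX k (pull e.hom k z) = c * tr hX' k z := by
  have hψ : tr hX (2 * n) ∘ₗ pull e.hom (2 * n) ≠ 0 := by
    intro h
    apply tr_top_ne_zero hX
    refine LinearMap.ext fun x ↦ ?_
    have hx := LinearMap.congr_fun h (pull e.inv (2 * n) x)
    rw [LinearMap.comp_apply, pull_hom_pull_inv_apply] at hx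
    exact hx
  obtain ⟨c, hc, hcφ⟩ := exists_ne_zero_eq_smul_of_finrank_eq_one' (finrank_bettiCohomology_top hX')
    (tr hX (2 * n) ∘ₗ pull e.hom (2 * n)) (tr hX' (2 * n)) hψ (tr_top_ne_zero hX')
  refine ⟨c, hc, fun k z ↦ ?_⟩
  by_cases hk : k = 2 * n
  · subst hk
    have h := LinearMap.congr_fun hcφ z
    rw [LinearMap.comp_apply, LinearMap.smul_apply, smul_eq_mul] at h
    exact h
  · rw [tr_of_ne hX hk, tr_of_ne hX' hk, LinearMap.zero_apply, LinearMap.zero_apply, mul_zero]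

/-- **Trace isometries transport by conjugation.** Let `e : X ≅ X'` be an isomorphism of smooth
projective `n`-folds and `gᵢ : Hⁱ(X') → Hⁱ(X')`, `gⱼ : Hʲ(X') → Hʲ(X')` linear maps preserving the
trace pairing of `X'`, `tr(gᵢ x ∪ gⱼ y) = tr(x ∪ y)`. Then the conjugates `e^* ∘ gᵢ ∘ (e⁻¹)^*`,
`e^* ∘ gⱼ ∘ (e⁻¹)^*` preserve the trace pairing of `X` (the scalar of
`exists_tr_comp_pull_eq_mul_of_iso` cancels; `e^*` is multiplicative, Hatcher Prop. 3.10). This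
transports the clauses `Cen`/`Deck (ii)` of the routes from a model to any isomorphic variety.
[cite: HatcherAT2002, §3.2 Prop. 3.10 and §3.3 Thm. 3.26] -/
theorem tr_cup_conj_conj_of_iso (hX : IsSmoothProjective n X) (hX' : IsSmoothProjective n X')
    (e : X ≅ X') {i j : ℕ} (gi : bettiCohomology X' i →ₗ[ℚ] bettiCohomology X' i)
    (gj : bettiCohomology X' j →ₗ[ℚ] bettiCohomology X' j)
    (hg : ∀ x y, tr hX' (i + j) (cup X' i j (gi x) (gj y)) = tr hX' (i + j) (cup X' i j x y))
    (x : bettiCohomology X i) (y : bettiCohomology X j) :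
    tr hX (i + j) (cup X i j (pull e.hom i (gi (pull e.inv i x))) (pull e.hom j (gj (pull e.inv j y)))) =
      tr hX (i + j) (cup X i j x y) := by
  obtain ⟨c, -, hc⟩ := exists_tr_comp_pull_eq_mul_of_iso hX hX' e
  rw [← pull_cup, hc, hg]
  conv_rhs => rw [← pull_hom_pull_inv_apply e i x, ← pull_hom_pull_inv_apply e j y, ← pull_cup, hc]

/-- The same for linear EQUIVALENCES written with `LinearEquiv.trans` (the shape in which the routes
quantify, `g : H³ ≃ₗ[ℚ] H³`): if `g'` preserves the trace pairing of `X'` then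
`g := φ g' φ⁻¹ = φ.trans (g'.trans φ.symm)` (`x ↦ e^* (g' ((e⁻¹)^* x))`, `φ = pullEquiv e k`)
preserves that of `X`. [cite: HatcherAT2002, §3.2 Prop. 3.10 and §3.3 Thm. 3.26] -/
theorem tr_cup_conj_of_iso (hX : IsSmoothProjective n X) (hX' : IsSmoothProjective n X')
    (e : X ≅ X') {k : ℕ} (g' : bettiCohomology X' k ≃ₗ[ℚ] bettiCohomology X' k)
    (hg : ∀ x y, tr hX' (k + k) (cup X' k k (g' x) (g' y)) = tr hX' (k + k) (cup X' k k x y))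
    (x y : bettiCohomology X k) :
    tr hX (k + k) (cup X k k ((pullEquiv e k).trans (g'.trans (pullEquiv e k).symm) x)
        ((pullEquiv e k).trans (g'.trans (pullEquiv e k).symm) y)) = tr hX (k + k) (cup X k k x y) :=
  tr_cup_conj_conj_of_iso hX hX' e g'.toLinearMap g'.toLinearMap hg x y

/-- **Commutation with the deck transports**: if `g'` commutes with `σ'^*` on `Hᵏ(X')` then
`φ g' φ⁻¹ = φ.trans (g'.trans φ.symm)` commutes with `(e ≫ σ' ≫ e⁻¹)^*` on `Hᵏ(X)` (`φ = pullEquiv e k`)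
— the first clause of `Cen`. [cite: HatcherAT2002, §3.1 p. 198] -/
theorem comm_conj_of_iso (e : X ≅ X') (σ' : X' ⟶ X') {k : ℕ}
    (g' : bettiCohomology X' k ≃ₗ[ℚ] bettiCohomology X' k)
    (hg : ∀ x, g' (pull σ' k x) = pull σ' k (g' x)) (x : bettiCohomology X k) :
    (pullEquiv e k).trans (g'.trans (pullEquiv e k).symm) (pull (e.hom ≫ σ' ≫ e.inv) k x) =
      pull (e.hom ≫ σ' ≫ e.inv) k ((pullEquiv e k).trans (g'.trans (pullEquiv e k).symm) x) := by
  simp only [LinearEquiv.trans_apply, pullEquiv_apply, pullEquiv_symm_apply, pull_conj_of_iso_apply,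
    pull_inv_pull_hom_apply, hg]

/-- Conversely every `σ^*`-commuting map of `X` is the conjugate of a `σ'^*`-commuting map of `X'`:
`g' := φ⁻¹ g φ = φ.symm.trans (g.trans φ)` (`y ↦ (e⁻¹)^* (g (e^* y))`) commutes with `σ'^*` when `g`
commutes with `(e ≫ σ' ≫ e⁻¹)^*`. [cite: HatcherAT2002, §3.1 p. 198] -/
theorem comm_conj_symm_of_iso (e : X ≅ X') (σ' : X' ⟶ X') {k : ℕ}
    (g : bettiCohomology X k ≃ₗ[ℚ] bettiCohomology X k)
    (hg : ∀ x, g (pull (e.hom ≫ σ' ≫ e.inv) k x) = pull (e.hom ≫ σ' ≫ e.inv) k (g x))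
    (y : bettiCohomology X' k) :
    (pullEquiv e k).symm.trans (g.trans (pullEquiv e k)) (pull σ' k y) =
      pull σ' k ((pullEquiv e k).symm.trans (g.trans (pullEquiv e k)) y) := by
  have h := hg (pull e.hom k y)
  rw [pull_conj_of_iso_apply, pull_inv_pull_hom_apply] at h
  simp only [LinearEquiv.trans_apply, pullEquiv_apply, pullEquiv_symm_apply, h, pull_conj_of_iso_apply,
    pull_inv_pull_hom_apply]

/-- The trace isometry clause read backwards: if `g` preserves the trace pairing of `X` then
`φ⁻¹ g φ = φ.symm.trans (g.trans φ)` preserves that of `X'`. [cite: HatcherAT2002, §3.2 Prop. 3.10 and §3.3 Thm. 3.26] -/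
theorem tr_cup_conj_symm_of_iso (hX : IsSmoothProjective n X) (hX' : IsSmoothProjective n X')
    (e : X ≅ X') {k : ℕ} (g : bettiCohomology X k ≃ₗ[ℚ] bettiCohomology X k)
    (hg : ∀ x y, tr hX (k + k) (cup X k k (g x) (g y)) = tr hX (k + k) (cup X k k x y))
    (x y : bettiCohomology X' k) :
    tr hX' (k + k) (cup X' k k ((pullEquiv e k).symm.trans (g.trans (pullEquiv e k)) x)
        ((pullEquiv e k).symm.trans (g.trans (pullEquiv e k)) y)) = tr hX' (k + k) (cup X' k k x y) := by
  have h := tr_cup_conj_conj_of_iso hX' hX e.symm g.toLinearMap g.toLinearMap hg x y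
  simpa only [LinearEquiv.trans_apply, pullEquiv_apply, pullEquiv_symm_apply, Iso.symm_hom,
    Iso.symm_inv, LinearEquiv.coe_coe] using h

/-- **Clause (ii) of `Deck` transports**: if `σ'^*` preserves the trace pairing of `X'` on `Hᵏ`, then
`(e ≫ σ' ≫ e⁻¹)^*` preserves that of `X`. [cite: HatcherAT2002, §3.2 Prop. 3.10 and §3.3 Thm. 3.26] -/
theorem tr_cup_pull_conj_of_iso (hX : IsSmoothProjective n X) (hX' : IsSmoothProjective n X')
    (e : X ≅ X') {σ' : X' ⟶ X'} {k : ℕ}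
    (hσ' : ∀ x y, tr hX' (k + k) (cup X' k k (pull σ' k x) (pull σ' k y)) = tr hX' (k + k) (cup X' k k x y))
    (x y : bettiCohomology X k) :
    tr hX (k + k) (cup X k k (pull (e.hom ≫ σ' ≫ e.inv) k x) (pull (e.hom ≫ σ' ≫ e.inv) k y)) =
      tr hX (k + k) (cup X k k x y) := by
  rw [pull_conj_of_iso_apply, pull_conj_of_iso_apply]
  exact tr_cup_conj_conj_of_iso hX hX' e (pull σ' k) (pull σ' k) hσ' x y

/-! ### §4b The commutator clause `Comm` transports -/

/-- Conjugation `g ↦ φ⁻¹ g φ = φ.symm.trans (g.trans φ)` is multiplicative on commutators. [folklore] -/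
private theorem conj_commutator {V W : Type*} [AddCommGroup V] [Module ℚ V] [AddCommGroup W] [Module ℚ W]
    (φ : V ≃ₗ[ℚ] W) (g h : V ≃ₗ[ℚ] V) :
    φ.symm.trans ((g * h * g⁻¹ * h⁻¹).trans φ) =
      φ.symm.trans (g.trans φ) * φ.symm.trans (h.trans φ) * (φ.symm.trans (g.trans φ))⁻¹ *
        (φ.symm.trans (h.trans φ))⁻¹ := by
  refine LinearEquiv.ext fun w ↦ ?_
  simp only [LinearEquiv.mul_apply, LinearEquiv.coe_inv, LinearEquiv.trans_apply,
    LinearEquiv.symm_trans_apply, LinearEquiv.symm_symm, LinearEquiv.symm_apply_apply]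

/-- **The commutator clause transports along an isomorphism.** Let `e : X ≅ X'` be an isomorphism of
smooth projective `n`-folds, `σ' : X' ⟶ X'`, `σ := e ≫ σ' ≫ e⁻¹`, and call `g ∈ GL(Hᵏ)` *central for
`σ`* when it commutes with `σ^*` and preserves the trace pairing (the routes' `Cen`). If on `X'` every
commutator `g'h'g'⁻¹h'⁻¹` of `σ'`-central elements lies in the Hodge group `Hg(Hᵏ(X'))`, then on `X`
every commutator of `σ`-central elements lies in `Hg(Hᵏ(X))`: `φ⁻¹(·)φ`, `φ = (e⁻¹)^*`, carries
`σ`-central to `σ'`-central (`comm_conj_symm_of_iso`, `tr_cup_conj_symm_of_iso`), commutators to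
commutators, and `Hg(Hᵏ(X)) = φ⁻¹ Hg(Hᵏ(X')) φ`-membership is `mem_hodgeGroup_iff_of_iso`. This is
the `Comm` half of the transfer "K1 on the models ⇒ K1" (`stub_modelTransfer`; the model is reached by
`IsHypersurfaceCutOutBy.nonempty_iso_hypersurface`, `IsSmoothProjective.of_iso`).
[cite: Deligne1982HodgeCycles, I Prop. 3.4] [cite: HatcherAT2002, §3.3 Thm. 3.26] -/
theorem commutator_mem_hodgeGroup_of_iso [Motives.HodgeTensorFacts.{0, 0}]
    (hHD : exists_isReal_hodgeModel) (hI : hodgePQ_independent_of_hodgeModel)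
    (hX : IsSmoothProjective n X) (hX' : IsSmoothProjective n X') (e : X ≅ X') (σ' : X' ⟶ X') (k : ℕ)
    (hComm' : haveI := finite hX' k
      ∀ g' h' : bettiCohomology X' k ≃ₗ[ℚ] bettiCohomology X' k,
        ((∀ x, g' (pull σ' k x) = pull σ' k (g' x)) ∧
            ∀ x y, tr hX' (k + k) (cup X' k k (g' x) (g' y)) = tr hX' (k + k) (cup X' k k x y)) →
        ((∀ x, h' (pull σ' k x) = pull σ' k (h' x)) ∧
            ∀ x y, tr hX' (k + k) (cup X' k k (h' x) (h' y)) = tr hX' (k + k) (cup X' k k x y)) →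
        g' * h' * g'⁻¹ * h'⁻¹ ∈ (hodge hHD hX' k).hodgeGroup)
    (g h : bettiCohomology X k ≃ₗ[ℚ] bettiCohomology X k)
    (hg : (∀ x, g (pull (e.hom ≫ σ' ≫ e.inv) k x) = pull (e.hom ≫ σ' ≫ e.inv) k (g x)) ∧
      ∀ x y, tr hX (k + k) (cup X k k (g x) (g y)) = tr hX (k + k) (cup X k k x y))
    (hh : (∀ x, h (pull (e.hom ≫ σ' ≫ e.inv) k x) = pull (e.hom ≫ σ' ≫ e.inv) k (h x)) ∧
      ∀ x y, tr hX (k + k) (cup X k k (h x) (h y)) = tr hX (k + k) (cup X k k x y)) :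
    haveI := finite hX k
    g * h * g⁻¹ * h⁻¹ ∈ (hodge hHD hX k).hodgeGroup := by
  haveI := finite hX k; haveI := finite hX' k
  rw [mem_hodgeGroup_iff_of_iso hHD hI hX hX' e k, conj_commutator]
  exact hComm' _ _ ⟨comm_conj_symm_of_iso e σ' g hg.1, tr_cup_conj_symm_of_iso hX hX' e g hg.2⟩
    ⟨comm_conj_symm_of_iso e σ' h hh.1, tr_cup_conj_symm_of_iso hX hX' e h hh.2⟩

/-- **`Comm` transports, quantified form**: the routes' clause
`Comm X hX σ := ∀ g h, Cen g → Cen h → g h g⁻¹ h⁻¹ ∈ Hg(Hᵏ(X))` for `σ = e ≫ σ' ≫ e⁻¹` follows from the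
same clause for `σ'` on `X'`. [cite: Deligne1982HodgeCycles, I Prop. 3.4] [cite: HatcherAT2002, §3.3 Thm. 3.26] -/
theorem comm_of_iso [Motives.HodgeTensorFacts.{0, 0}]
    (hHD : exists_isReal_hodgeModel) (hI : hodgePQ_independent_of_hodgeModel)
    (hX : IsSmoothProjective n X) (hX' : IsSmoothProjective n X') (e : X ≅ X') (σ' : X' ⟶ X') (k : ℕ)
    (hComm' : haveI := finite hX' k
      ∀ g' h' : bettiCohomology X' k ≃ₗ[ℚ] bettiCohomology X' k,
        ((∀ x, g' (pull σ' k x) = pull σ' k (g' x)) ∧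
            ∀ x y, tr hX' (k + k) (cup X' k k (g' x) (g' y)) = tr hX' (k + k) (cup X' k k x y)) →
        ((∀ x, h' (pull σ' k x) = pull σ' k (h' x)) ∧
            ∀ x y, tr hX' (k + k) (cup X' k k (h' x) (h' y)) = tr hX' (k + k) (cup X' k k x y)) →
        g' * h' * g'⁻¹ * h'⁻¹ ∈ (hodge hHD hX' k).hodgeGroup) :
    haveI := finite hX k
    ∀ g h : bettiCohomology X k ≃ₗ[ℚ] bettiCohomology X k,
      ((∀ x, g (pull (e.hom ≫ σ' ≫ e.inv) k x) = pull (e.hom ≫ σ' ≫ e.inv) k (g x)) ∧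
          ∀ x y, tr hX (k + k) (cup X k k (g x) (g y)) = tr hX (k + k) (cup X k k x y)) →
      ((∀ x, h (pull (e.hom ≫ σ' ≫ e.inv) k x) = pull (e.hom ≫ σ' ≫ e.inv) k (h x)) ∧
          ∀ x y, tr hX (k + k) (cup X k k (h x) (h y)) = tr hX (k + k) (cup X k k x y)) →
      g * h * g⁻¹ * h⁻¹ ∈ (hodge hHD hX k).hodgeGroup :=
  fun g h hg hh ↦ commutator_mem_hodgeGroup_of_iso hHD hI hX hX' e σ' k hComm' g h hg hh

/-! ### §5 Eigen-Hodge numbers transport -/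

/-- The `μ`-eigenspace of the conjugate `(e ≫ σ' ≫ e⁻¹)^*_ℂ` is the pull-back of that of `σ'^*_ℂ`
along `(e⁻¹)^*_ℂ`. [cite: HatcherAT2002, §3.1 p. 198] -/
theorem eigenspace_pull_conj_eq_comap (e : X ≅ X') (σ' : X' ⟶ X') (k : ℕ) (μ : ℂ) :
    Module.End.eigenspace ((pull (e.hom ≫ σ' ≫ e.inv) k).baseChange ℂ) μ =
      (Module.End.eigenspace ((pull σ' k).baseChange ℂ) μ).comap ((pull e.inv k).baseChange ℂ) := by
  have hEF : (pull e.inv k).baseChange ℂ ∘ₗ (pull e.hom k).baseChange ℂ = LinearMap.id := by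
    rw [← LinearMap.baseChange_comp, ← pull_comp, e.inv_hom_id, pull_id, LinearMap.baseChange_id]
  have hFE : (pull e.hom k).baseChange ℂ ∘ₗ (pull e.inv k).baseChange ℂ = LinearMap.id := by
    rw [← LinearMap.baseChange_comp, ← pull_comp, e.hom_inv_id, pull_id, LinearMap.baseChange_id]
  ext x
  rw [Submodule.mem_comap, Module.End.mem_eigenspace_iff, Module.End.mem_eigenspace_iff,
    pull_conj_of_iso, LinearMap.baseChange_comp, LinearMap.baseChange_comp, LinearMap.comp_apply,
    LinearMap.comp_apply]
  constructor
  · intro h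
    have h' := congrArg ((pull e.inv k).baseChange ℂ) h
    rw [← LinearMap.comp_apply ((pull e.inv k).baseChange ℂ), hEF, LinearMap.id_apply, map_smul] at h'
    exact h'
  · intro h
    rw [h, map_smul, ← LinearMap.comp_apply ((pull e.hom k).baseChange ℂ), hFE, LinearMap.id_apply]

/-- **Eigen-Hodge numbers transport along an isomorphism**: for `e : X ≅ X'`, a morphism
`σ' : X' ⟶ X'` and the transported `σ = e ≫ σ' ≫ e⁻¹`,
`dim_ℂ (E_μ(σ^*_ℂ) ∩ H^{p,q}(X)) = dim_ℂ (E_μ(σ'^*_ℂ) ∩ H^{p,q}(X'))` in every degree `k` — clause (iii)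
of the routes' `Deck` passes from the model to any isomorphic variety (both subspaces correspond
under the linear isomorphism `(e⁻¹)^*_ℂ`: §2 for the pieces, `eigenspace_pull_conj_eq_comap` for the
eigenspaces). [cite: VoisinHodgeI2002, §7.3.2] [cite: HatcherAT2002, §3.1 p. 198] -/
theorem finrank_eigenspace_inf_piece_eq_of_iso (hHD : exists_isReal_hodgeModel)
    (hI : hodgePQ_independent_of_hodgeModel) (hX : IsSmoothProjective n X)
    (hX' : IsSmoothProjective m X') (e : X ≅ X') (σ' : X' ⟶ X') (k : ℕ) (μ : ℂ) (p q : ℤ) :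
    finrank ℂ ↥(Module.End.eigenspace ((pull (e.hom ≫ σ' ≫ e.inv) k).baseChange ℂ) μ ⊓
        (hodge hHD hX k).piece p q) =
      finrank ℂ ↥(Module.End.eigenspace ((pull σ' k).baseChange ℂ) μ ⊓ (hodge hHD hX' k).piece p q) := by
  set E : ℂ ⊗[ℚ] bettiCohomology X k ≃ₗ[ℂ] ℂ ⊗[ℚ] bettiCohomology X' k :=
    (pullEquiv e k).baseChange ℚ ℂ _ _ with hEdef
  have hE : (E : ℂ ⊗[ℚ] bettiCohomology X k →ₗ[ℂ] ℂ ⊗[ℚ] bettiCohomology X' k) =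
      (pull e.inv k).baseChange ℂ := rfl
  rw [eigenspace_pull_conj_eq_comap, hodge_piece_eq_comap_of_iso hHD hI hX hX' e k,
    ← Submodule.comap_inf, ← hE, Submodule.comap_equiv_eq_map_symm]
  exact LinearEquiv.finrank_map_eq E.symm _

/-! ### §6 The transport kit of a fibre identification: `φ = (e⁻¹)^*`, `B = φ^*(tr ∘ ∪)`,
`τ = (e ≫ σ' ≫ e⁻¹)^* = φ⁻¹ σ'^* φ` (clauses (COMPAT), (HG) of `stub_signPencilEnvelope`) -/

section Kit

variable {Y : Motives.SchemeOver ℂ}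

/-- `φ τ = σ'^* φ`: the identification `φ = (e⁻¹)^*` intertwines the transported deck
`τ = (e ≫ σ' ≫ e⁻¹)^*` on `Hᵏ(Y)` with `σ'^*` on `Hᵏ(X')`. [cite: HatcherAT2002, §3.1 p. 198] -/
theorem pullEquiv_pull_conj_apply (e : Y ≅ X') (σ' : X' ⟶ X') (k : ℕ) (x : bettiCohomology Y k) :
    pullEquiv e k (pull (e.hom ≫ σ' ≫ e.inv) k x) = pull σ' k (pullEquiv e k x) := by
  rw [pullEquiv_apply, pullEquiv_apply, pull_conj_of_iso_apply, pull_inv_pull_hom_apply]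

/-- `τ = φ⁻¹ σ'^* φ` as linear maps: `(e ≫ σ' ≫ e⁻¹)^* = φ.symm ∘ σ'^* ∘ φ`, `φ = pullEquiv e k`.
[cite: HatcherAT2002, §3.1 p. 198] -/
theorem pull_conj_eq_pullEquiv_conj (e : Y ≅ X') (σ' : X' ⟶ X') (k : ℕ) :
    pull (e.hom ≫ σ' ≫ e.inv) k =
      (pullEquiv e k).symm.toLinearMap ∘ₗ pull σ' k ∘ₗ (pullEquiv e k).toLinearMap := by
  rw [pull_conj_of_iso, pullEquiv_toLinearMap, pullEquiv_symm_toLinearMap]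

/-- **The transported form `B := φ^*(tr_{X'} ∘ ∪)`** on `Hᵏ(Y)`, `B x y = tr_{X'}(φ x ∪ φ y)`
(`φ = pullEquiv e k`), evaluated. [cite: HatcherAT2002, §3.3 Thm. 3.26] -/
theorem trCup_comp_pullEquiv_apply (hX' : IsSmoothProjective m X') (e : Y ≅ X') (k : ℕ)
    (x y : bettiCohomology Y k) :
    LinearMap.BilinForm.comp ((cup X' k k).compr₂ (tr hX' (k + k))) (pullEquiv e k).toLinearMap
        (pullEquiv e k).toLinearMap x y = tr hX' (k + k) (cup X' k k (pullEquiv e k x) (pullEquiv e k y)) :=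
  rfl

/-- `B = φ^*(tr_{X'} ∘ ∪)` is invariant under the transported deck `τ = (e ≫ σ' ≫ e⁻¹)^*` when `σ'^*`
preserves `tr_{X'} ∘ ∪`. [cite: HatcherAT2002, §3.2 Prop. 3.10 and §3.3 Thm. 3.26] -/
theorem trCup_comp_pullEquiv_pull_conj (hX' : IsSmoothProjective m X') (e : Y ≅ X') {σ' : X' ⟶ X'}
    {k : ℕ}
    (hσ' : ∀ x y, tr hX' (k + k) (cup X' k k (pull σ' k x) (pull σ' k y)) = tr hX' (k + k) (cup X' k k x y))
    (x y : bettiCohomology Y k) :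
    LinearMap.BilinForm.comp ((cup X' k k).compr₂ (tr hX' (k + k))) (pullEquiv e k).toLinearMap
        (pullEquiv e k).toLinearMap (pull (e.hom ≫ σ' ≫ e.inv) k x) (pull (e.hom ≫ σ' ≫ e.inv) k y) =
      LinearMap.BilinForm.comp ((cup X' k k).compr₂ (tr hX' (k + k))) (pullEquiv e k).toLinearMap
        (pullEquiv e k).toLinearMap x y := by
  rw [trCup_comp_pullEquiv_apply, trCup_comp_pullEquiv_apply, pullEquiv_pull_conj_apply,
    pullEquiv_pull_conj_apply, hσ']

/-- `B = φ^*(tr_{X'} ∘ ∪)` on `Hᵏ(Y)` is alternating for odd `k` (graded commutativity on `X'`).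
[cite: HatcherAT2002, §3.2 Thm. 3.11] -/
theorem isAlt_trCup_comp_pullEquiv (hX' : IsSmoothProjective m X') (e : Y ≅ X') {k : ℕ} (hk : Odd k) :
    (LinearMap.BilinForm.comp ((cup X' k k).compr₂ (tr hX' (k + k))) (pullEquiv e k).toLinearMap
        (pullEquiv e k).toLinearMap).IsAlt :=
  fun x ↦ isAlt_tr_cup_of_odd hX' hk (pullEquiv e k x)

/-- `B = φ^*(tr_{X'} ∘ ∪)` on the middle cohomology `Hⁿ(Y)` is non-degenerate (Poincaré duality on the
smooth projective `n`-fold `X'`, `nondegenerate_tr_cup`, transported along the linear isomorphism `φ`).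
[cite: HatcherAT2002, §3.3 Prop. 3.38] -/
theorem nondegenerate_trCup_comp_pullEquiv (hX' : IsSmoothProjective n X') (e : Y ≅ X') :
    (LinearMap.BilinForm.comp ((cup X' n n).compr₂ (tr hX' (n + n))) (pullEquiv e n).toLinearMap
        (pullEquiv e n).toLinearMap).Nondegenerate := by
  have h : LinearMap.BilinForm.comp ((cup X' n n).compr₂ (tr hX' (n + n))) (pullEquiv e n).toLinearMap
      (pullEquiv e n).toLinearMap =
        LinearMap.BilinForm.congr (pullEquiv e n).symm ((cup X' n n).compr₂ (tr hX' (n + n))) := by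
    refine LinearMap.ext fun x ↦ LinearMap.ext fun y ↦ ?_
    rw [LinearMap.BilinForm.comp_apply, LinearMap.BilinForm.congr_apply, LinearEquiv.symm_symm]
    rfl
  rw [h, LinearMap.BilinForm.nondegenerate_congr_iff]
  exact nondegenerate_tr_cup hX'

/-- **(HG) for a model Hodge structure on the fibre**: for `e : Y ≅ X'` of smooth projective varieties
and ANY Hodge-symmetric Hodge model `A` of `Y`, `φ = (e⁻¹)^*` carries the Hodge group of
`A.hodgeStructure hY hA k` (the carrier of `deligne_finiteIndex_monodromy_le_mumfordTateGroup` on a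
fibre of a family) into the Hodge group of `BettiUniverse.hodge` on `X'`:
`k' ∈ Hg(A; Hᵏ(Y)) ⇒ φ k' φ⁻¹ = (φ.symm.trans k').trans φ ∈ Hg(Hᵏ(X'))` (§2 model independence + §3).
[cite: Deligne1982HodgeCycles, I Prop. 3.4] [cite: VoisinHodgeI2002, §7.1.1 and §7.3.2] -/
theorem mem_hodgeGroup_of_iso_of_hodgeModel [Motives.HodgeTensorFacts.{0, 0}]
    (hHD : exists_isReal_hodgeModel) (hI : hodgePQ_independent_of_hodgeModel)
    (hY : IsSmoothProjective n Y) (hX' : IsSmoothProjective m X') (e : Y ≅ X')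
    (A : HodgeModel n Y) (hA : A.IsHodgeSymmetric) (k : ℕ) [Module.Finite ℚ (bettiCohomology Y k)]
    (k' : bettiCohomology Y k ≃ₗ[ℚ] bettiCohomology Y k)
    (hk' : k' ∈ (A.hodgeStructure hY hA k).hodgeGroup) :
    haveI := finite hX' k
    ((pullEquiv e k).symm.trans k').trans (pullEquiv e k) ∈ (hodge hHD hX' k).hodgeGroup := by
  rw [HodgeModel.hodgeStructure_eq_hodge hHD hI hY A hA k] at hk'
  exact mem_hodgeGroup_of_iso hHD hI hY hX' e k k' hk'

/-- **The transport kit, packaged in the quantifier order of `stub_signPencilEnvelope`.** Let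
`e : Y ≅ X'` be an isomorphism of smooth projective `n`-folds, `n` odd, `σ' : X' ⟶ X'` with
`(σ'^*)² = 1` on `Hⁿ(X')` preserving `tr_{X'} ∘ ∪`, and `A` any Hodge-symmetric Hodge model of `Y`. Then
there are `φ : Hⁿ(Y) ≃ Hⁿ(X')`, an alternating non-degenerate bilinear form `B` on `Hⁿ(Y)` and an
involution `τ` of `Hⁿ(Y)` with: `B` `τ`-invariant, `φ τ = σ'^* φ`, `B x y = tr_{X'}(φ x ∪ φ y)`, and
`φ (·) φ⁻¹` carrying `Hg(A; Hⁿ(Y))` into `Hg(Hⁿ(X'))` — namely `φ = (e⁻¹)^*`, `B = φ^*(tr ∘ ∪)`,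
`τ = (e ≫ σ' ≫ e⁻¹)^*`. (Clauses (COMPAT) + (HG); the Picard–Lefschetz clauses of the envelope are
not touched.) [cite: HatcherAT2002, §3.3 Thm. 3.26 and Prop. 3.38] [cite: Deligne1982HodgeCycles, I Prop. 3.4] -/
theorem exists_transportKit [Motives.HodgeTensorFacts.{0, 0}]
    (hHD : exists_isReal_hodgeModel) (hI : hodgePQ_independent_of_hodgeModel)
    (hY : IsSmoothProjective n Y) (hX' : IsSmoothProjective n X') (e : Y ≅ X') (hn : Odd n)
    {σ' : X' ⟶ X'} (h1 : pull σ' n ^ 2 = 1)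
    (h2 : ∀ x y, tr hX' (n + n) (cup X' n n (pull σ' n x) (pull σ' n y)) = tr hX' (n + n) (cup X' n n x y))
    (A : HodgeModel n Y) (hA : A.IsHodgeSymmetric) [Module.Finite ℚ (bettiCohomology Y n)] :
    ∃ (φ : bettiCohomology Y n ≃ₗ[ℚ] bettiCohomology X' n) (B : LinearMap.BilinForm ℚ (bettiCohomology Y n))
      (_ : B.IsAlt) (_ : B.Nondegenerate) (τ : bettiCohomology Y n →ₗ[ℚ] bettiCohomology Y n)
      (_ : τ ^ 2 = 1),
      (∀ x y, B (τ x) (τ y) = B x y) ∧ (∀ x, φ (τ x) = pull σ' n (φ x)) ∧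
        (∀ x y, B x y = tr hX' (n + n) (cup X' n n (φ x) (φ y))) ∧
        (haveI := finite hX' n
          ∀ k' : bettiCohomology Y n ≃ₗ[ℚ] bettiCohomology Y n,
            k' ∈ (A.hodgeStructure hY hA n).hodgeGroup →
              (φ.symm.trans k').trans φ ∈ (hodge hHD hX' n).hodgeGroup) :=
  ⟨pullEquiv e n, LinearMap.BilinForm.comp ((cup X' n n).compr₂ (tr hX' (n + n)))
      (pullEquiv e n).toLinearMap (pullEquiv e n).toLinearMap,
    isAlt_trCup_comp_pullEquiv hX' e hn, nondegenerate_trCup_comp_pullEquiv hX' e,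
    pull (e.hom ≫ σ' ≫ e.inv) n, pull_conj_sq_eq_one_of_iso e h1,
    trCup_comp_pullEquiv_pull_conj hX' e h2, pullEquiv_pull_conj_apply e σ' n,
    trCup_comp_pullEquiv_apply hX' e n,
    fun k' hk' ↦ mem_hodgeGroup_of_iso_of_hodgeModel hHD hI hY hX' e A hA n k' hk'⟩

end Kit

end HodgeTheory

end BettiUniverse

end Literature.AlgebraicGeometry.HodgeTheory

end
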